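import Summits.Parity.BatemanHorn.Theorems.AlmostPrimeZerosSystemMomentDeficitLinearK1Rough

/-!
# Crux `SystemMomentDeficit` (stmt-Parity-11326), line `Ideator3Sketch`: K1 for linear systems (main theorem)

The decorrelated covariance bound `Cov(W, N) ≥ −C` (registered stub
`stub_decorrelatedCovarianceBound`, the crux's analytic core) needs no arithmetic input when every
member of the system is LINEAR: a value `fᵢ(n) = aᵢ n + bᵢ ≤ Aᵢ x` (`0 ≤ n ≤ x`) has a prime
factor `p > x` only if `fᵢ(n) = p·c` with `c < Aᵢ`, and for each `c` the map `n ↦ p` is injective,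
so `Σ_{n ≤ x} N(n) ≤ Σᵢ Aᵢ (π(Aᵢ x) + √(Aᵢ x) + 1) ≪ x / log x` (Chebyshev), while
`|W(n)| ≤ 2 Σᵢ log₂ (Aᵢ x) ≪ log x`; hence `|Cov(W, N)| ≤ 2 sup|W| · E N = O(1)`.

Main results:
* `sum_roughCount_le_of_natDegree_eq_one` — `Σ_{n ≤ x} (s(g(n)⁺) − #{q ∈ PP(x) : q ∣ g(n)⁺}) ≤ A(π(Ax) + √(Ax) + 1)`
  for `g` of degree `1` with positive leading coefficient, `A = 2 Σ_j |coeff_j g|`;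
* `decorrelatedCovarianceBound_of_natDegree_eq_one` — K1 for all-linear Bateman–Horn systems.

Notation (docstrings only).  `Y = x + 1`, `E g = Y⁻¹ Σ_{0 ≤ n ≤ x} g(n)`, `PP(z)` = primes `≤ z` ∪
prime squares `≤ z`, `s(m) = Σ_{p^v ∥ m} min(v, 2)`.  Everything is [folklore].
-/

namespace Summit.Parity.BatemanHorn.Cruxes.SystemMomentDeficit.Ideator3Sketch

open scoped BigOperators
open Finset Polynomial
open Literature.NumberTheory.Sieve
open Summit.Parity.BatemanHorn.Theorems.AlmostPrimeZeros.SystemMertens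

/-! ### K1 for all-linear systems -/

/-- **The decorrelated covariance bound for ALL-LINEAR Bateman–Horn systems** (stub K1 of line
`Ideator3Sketch`, restricted to `deg fᵢ = 1` for every `i`; e.g. prime `k`-tuple systems): for
such `f` there is `C` with `Cov_{0 ≤ n ≤ x}(W, N) ≥ −C` for all `x ≥ 16`.  No arithmetic input:
`0 ≤ N`, `Σ_{n ≤ x} N(n) ≤ Σᵢ 8Aᵢ² x/log x` (rough pairs along a linear polynomial + Chebyshev),
`|W(n)| ≤ 2 Σᵢ log₂(Aᵢ x)` (few prime factors), so `|Cov(W, N)| ≤ 2 sup|W| · E N = O(1)`. -/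
theorem decorrelatedCovarianceBound_of_natDegree_eq_one :
    ∀ (k : ℕ) (f : Fin k → ℤ[X]), IsBatemanHornSystem f → (∀ i, (f i).natDegree = 1) →
      ∃ C : ℝ, ∀ x : ℕ, 16 ≤ x →
      -C ≤
        (∑ n ∈ Finset.range (x + 1),
            (∑ i, ∑ q ∈ (Nat.primesLE (Nat.sqrt (Nat.sqrt x)) ∪
                ((Nat.primesLE (Nat.sqrt (Nat.sqrt x))).filter
                  (fun p => p ^ 2 ≤ Nat.sqrt (Nat.sqrt x))).image (fun p => p ^ 2)).filter
                (fun q => q ∣ ((f i).eval (n : ℤ)).toNat ∧ ((f i).eval (n : ℤ)).toNat ≠ 0),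
              (1 - 2 * ArithmeticFunction.vonMangoldt q / Real.log (Nat.sqrt (Nat.sqrt x)))) *
            (((∑ i, (((f i).eval (n : ℤ)).toNat.factorization.sum fun _ v => min v 2) : ℕ) : ℝ) -
              ((∑ i, #((Nat.primesLE x ∪ ((Nat.primesLE x).filter (fun p => p ^ 2 ≤ x)).image
                  (fun p => p ^ 2)).filter
                (fun q => q ∣ ((f i).eval (n : ℤ)).toNat ∧ ((f i).eval (n : ℤ)).toNat ≠ 0)) : ℕ) : ℝ))) /
            ((x : ℝ) + 1) -
          (∑ n ∈ Finset.range (x + 1),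
              (∑ i, ∑ q ∈ (Nat.primesLE (Nat.sqrt (Nat.sqrt x)) ∪
                  ((Nat.primesLE (Nat.sqrt (Nat.sqrt x))).filter
                    (fun p => p ^ 2 ≤ Nat.sqrt (Nat.sqrt x))).image (fun p => p ^ 2)).filter
                  (fun q => q ∣ ((f i).eval (n : ℤ)).toNat ∧ ((f i).eval (n : ℤ)).toNat ≠ 0),
                (1 - 2 * ArithmeticFunction.vonMangoldt q / Real.log (Nat.sqrt (Nat.sqrt x))))) /
              ((x : ℝ) + 1) *
            ((∑ n ∈ Finset.range (x + 1),
                (((∑ i, (((f i).eval (n : ℤ)).toNat.factorization.sum fun _ v => min v 2) : ℕ) : ℝ) -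
                  ((∑ i, #((Nat.primesLE x ∪ ((Nat.primesLE x).filter (fun p => p ^ 2 ≤ x)).image
                      (fun p => p ^ 2)).filter
                    (fun q => q ∣ ((f i).eval (n : ℤ)).toNat ∧ ((f i).eval (n : ℤ)).toNat ≠ 0)) : ℕ) :
                    ℝ))) /
              ((x : ℝ) + 1)) := by
  intro k f hf hlin
  classical
  -- constants: `A i = 2 Σ_j |coeff_j (f i)| ≥ 2`, `S = Σ A_i²`, `L = Σ log A_i`
  set A : Fin k → ℕ := fun i => 2 * ∑ j ∈ range ((f i).natDegree + 1), ((f i).coeff j).natAbs with hA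
  have hA1 : ∀ i, 1 ≤ A i := by
    intro i
    have hlc := hf.leadingCoeff_pos i
    have h1 : ((f i).coeff (f i).natDegree).natAbs ≤
        ∑ j ∈ range ((f i).natDegree + 1), ((f i).coeff j).natAbs :=
      single_le_sum (f := fun j => ((f i).coeff j).natAbs) (fun _ _ => Nat.zero_le _)
        (mem_range.2 (Nat.lt_succ_self _))
    have h2 : 0 < ((f i).coeff (f i).natDegree).natAbs := by
      rw [Int.natAbs_pos]
      exact (ne_of_gt hlc)
    simp only [hA]
    omega
  set S : ℝ := ∑ i, ((A i : ℝ)) ^ 2 with hS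
  set L : ℝ := ∑ i, Real.log (A i) with hL
  have hS0 : 0 ≤ S := sum_nonneg fun i _ => by positivity
  have hL0 : 0 ≤ L := sum_nonneg fun i _ => Real.log_nonneg (by exact_mod_cast hA1 i)
  refine ⟨64 * S * (L + k), fun x hx => ?_⟩
  -- parameters
  set y : ℕ := Nat.sqrt (Nat.sqrt x) with hy
  have hx1 : 1 ≤ x := by omega
  have hxR : (16 : ℝ) ≤ x := by exact_mod_cast hx
  have hx0 : (0 : ℝ) < x := by linarith
  have hY0 : (0 : ℝ) < (x : ℝ) + 1 := by positivity
  have hlogx1 : 1 ≤ Real.log x := by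
    rw [Real.le_log_iff_exp_le hx0]
    have := Real.exp_one_lt_d9
    linarith
  have hlogx0 : 0 < Real.log x := by linarith
  have hy2 : 2 ≤ y := by
    have h4 : 4 ≤ Nat.sqrt x := Nat.le_sqrt.2 (by omega)
    exact Nat.le_sqrt.2 (by omega)
  have hlogy0 : 0 < Real.log y := Real.log_pos (by exact_mod_cast hy2)
  -- abbreviations for the two factors
  set PPy : Finset ℕ := Nat.primesLE y ∪ ((Nat.primesLE y).filter (fun p => p ^ 2 ≤ y)).image
    (fun p => p ^ 2) with hPPy
  set PPx : Finset ℕ := Nat.primesLE x ∪ ((Nat.primesLE x).filter (fun p => p ^ 2 ≤ x)).image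
    (fun p => p ^ 2) with hPPx
  set W : ℕ → ℝ := fun n => ∑ i, ∑ q ∈ PPy.filter
      (fun q => q ∣ ((f i).eval (n : ℤ)).toNat ∧ ((f i).eval (n : ℤ)).toNat ≠ 0),
      (1 - 2 * ArithmeticFunction.vonMangoldt q / Real.log y) with hW
  set N : ℕ → ℝ := fun n =>
      ((∑ i, (((f i).eval (n : ℤ)).toNat.factorization.sum fun _ v => min v 2) : ℕ) : ℝ) -
        ((∑ i, #(PPx.filter
          (fun q => q ∣ ((f i).eval (n : ℤ)).toNat ∧ ((f i).eval (n : ℤ)).toNat ≠ 0)) : ℕ) : ℝ) with hN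
  show -(64 * S * (L + k)) ≤ (∑ n ∈ range (x + 1), W n * N n) / ((x : ℝ) + 1) -
    (∑ n ∈ range (x + 1), W n) / ((x : ℝ) + 1) * ((∑ n ∈ range (x + 1), N n) / ((x : ℝ) + 1))
  -- `N ≥ 0` and `N` as a sum of natural differences
  have hNnat : ∀ n, N n = ∑ i, (((((f i).eval (n : ℤ)).toNat.factorization.sum fun _ v => min v 2) -
      #(PPx.filter (fun q => q ∣ ((f i).eval (n : ℤ)).toNat ∧ ((f i).eval (n : ℤ)).toNat ≠ 0)) : ℕ) : ℝ) := by
    intro n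
    simp only [hN]
    rw [Nat.cast_sum, Nat.cast_sum, ← sum_sub_distrib]
    refine sum_congr rfl fun i _ => ?_
    rw [Nat.cast_sub (card_PP_filter_le_capped x _)]
  have hN0 : ∀ n, 0 ≤ N n := fun n => by
    rw [hNnat]
    exact sum_nonneg fun i _ => Nat.cast_nonneg _
  -- `Σ_n N n ≤ 8 S x / log x`
  have hsumN : ∑ n ∈ range (x + 1), N n ≤ 8 * S * x / Real.log x := by
    calc ∑ n ∈ range (x + 1), N n
        = ∑ i, ((∑ n ∈ range (x + 1), ((((f i).eval (n : ℤ)).toNat.factorization.sum fun _ v => min v 2) -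
            #(PPx.filter (fun q => q ∣ ((f i).eval (n : ℤ)).toNat ∧ ((f i).eval (n : ℤ)).toNat ≠ 0))) : ℕ) : ℝ) := by
          simp_rw [hNnat]
          rw [sum_comm]
          exact sum_congr rfl fun i _ => (Nat.cast_sum _ _).symm
      _ ≤ ∑ i, (((A i * (Nat.primeCounting (A i * x) + (Nat.sqrt (A i * x) + 1))) : ℕ) : ℝ) := by
          refine sum_le_sum fun i _ => ?_
          exact_mod_cast sum_roughCount_le_of_natDegree_eq_one (f i) (hlin i) (hf.leadingCoeff_pos i) x hx1
      _ ≤ ∑ i, 8 * ((A i : ℝ)) ^ 2 * x / Real.log x :=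
          sum_le_sum fun i _ => roughPairs_bound_le (hA1 i) hx
      _ = 8 * S * x / Real.log x := by
          rw [hS, mul_sum, sum_mul, sum_div]
  have hEN : (∑ n ∈ range (x + 1), N n) / ((x : ℝ) + 1) ≤ 8 * S / Real.log x := by
    rw [div_le_iff₀ hY0]
    calc ∑ n ∈ range (x + 1), N n ≤ 8 * S * x / Real.log x := hsumN
      _ ≤ 8 * S / Real.log x * ((x : ℝ) + 1) := by
          rw [div_mul_eq_mul_div]
          refine div_le_div_of_nonneg_right ?_ hlogx0.le
          nlinarith
  have hEN0 : 0 ≤ (∑ n ∈ range (x + 1), N n) / ((x : ℝ) + 1) :=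
    div_nonneg (sum_nonneg fun n _ => hN0 n) hY0.le
  -- `|W n| ≤ B := 2 Σ_i Nat.log 2 (A_i x)` for `n ≤ x`
  set B : ℝ := ∑ i, (2 * (Nat.log 2 (A i * x) : ℝ)) with hB
  have hB0 : 0 ≤ B := sum_nonneg fun i _ => by positivity
  have hWB : ∀ n ∈ range (x + 1), |W n| ≤ B := by
    intro n hn
    have hnx : n ≤ x := Nat.lt_succ_iff.1 (mem_range.1 hn)
    simp only [hW]
    refine (abs_sum_le_sum_abs _ _).trans (sum_le_sum fun i _ => ?_)
    refine (abs_sum_le_sum_abs _ _).trans ?_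
    -- each weight has absolute value `≤ 1`
    have hw : ∀ q ∈ PPy.filter (fun q => q ∣ ((f i).eval (n : ℤ)).toNat ∧ ((f i).eval (n : ℤ)).toNat ≠ 0),
        |1 - 2 * ArithmeticFunction.vonMangoldt q / Real.log y| ≤ 1 := by
      intro q hq
      have hqy : q ∈ PPy := (mem_filter.1 hq).1
      obtain ⟨-, hq2, hqy'⟩ := isPrimePow_and_le_of_mem_PP hqy
      have h0 : 0 ≤ ArithmeticFunction.vonMangoldt q := ArithmeticFunction.vonMangoldt_nonneg
      have h1 : ArithmeticFunction.vonMangoldt q ≤ Real.log y :=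
        ArithmeticFunction.vonMangoldt_le_log.trans
          (Real.log_le_log (by exact_mod_cast (by omega : 0 < q)) (by exact_mod_cast hqy'))
      rw [abs_le]
      constructor
      · have : 2 * ArithmeticFunction.vonMangoldt q / Real.log y ≤ 2 := by
          rw [div_le_iff₀ hlogy0]; linarith
        linarith
      · have : 0 ≤ 2 * ArithmeticFunction.vonMangoldt q / Real.log y := by positivity
        linarith
    calc ∑ q ∈ PPy.filter (fun q => q ∣ ((f i).eval (n : ℤ)).toNat ∧ ((f i).eval (n : ℤ)).toNat ≠ 0),
          |1 - 2 * ArithmeticFunction.vonMangoldt q / Real.log y|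
        ≤ ∑ q ∈ PPy.filter (fun q => q ∣ ((f i).eval (n : ℤ)).toNat ∧ ((f i).eval (n : ℤ)).toNat ≠ 0),
            (1 : ℝ) := sum_le_sum hw
      _ = #(PPy.filter (fun q => q ∣ ((f i).eval (n : ℤ)).toNat ∧ ((f i).eval (n : ℤ)).toNat ≠ 0)) := by
          rw [sum_const, nsmul_eq_mul, mul_one]
      _ ≤ 2 * (Nat.log 2 ((f i).eval (n : ℤ)).toNat : ℝ) := by
          exact_mod_cast card_PP_filter_le_two_mul_log y _
      _ ≤ 2 * (Nat.log 2 (A i * x) : ℝ) := by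
          have hmono : Nat.log 2 ((f i).eval (n : ℤ)).toNat ≤ Nat.log 2 (A i * x) :=
            Nat.log_mono_right (toNat_eval_le_mul_of_natDegree_eq_one (hlin i) hx1 hnx)
          have : (Nat.log 2 ((f i).eval (n : ℤ)).toNat : ℝ) ≤ (Nat.log 2 (A i * x) : ℝ) := by
            exact_mod_cast hmono
          linarith
  -- `B ≤ 4 (L + k log x)`
  have hBle : B ≤ 4 * (L + k * Real.log x) := by
    have hlog2 : (1 : ℝ) / 2 ≤ Real.log 2 := by
      have := Real.log_two_gt_d9; linarith
    have hterm : ∀ i, (2 * (Nat.log 2 (A i * x) : ℝ)) ≤ 4 * (Real.log (A i) + Real.log x) := by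
      intro i
      have hAx0 : A i * x ≠ 0 := Nat.mul_ne_zero (by have := hA1 i; omega) (by omega)
      have h1 : (Nat.log 2 (A i * x) : ℝ) ≤ Real.log ((A i * x : ℕ) : ℝ) / Real.log 2 := by
        rw [le_div_iff₀ (Real.log_pos one_lt_two), ← Real.log_pow]
        exact Real.log_le_log (by positivity) (by exact_mod_cast Nat.pow_log_le_self 2 hAx0)
      have h2 : Real.log ((A i * x : ℕ) : ℝ) = Real.log (A i) + Real.log x := by
        push_cast
        rw [Real.log_mul (by have := hA1 i; positivity) hx0.ne']
      rw [h2] at h1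
      have hpos : 0 ≤ Real.log (A i) + Real.log x :=
        add_nonneg (Real.log_nonneg (by exact_mod_cast hA1 i)) hlogx0.le
      have h3 : (Real.log (A i) + Real.log x) / Real.log 2 ≤ 2 * (Real.log (A i) + Real.log x) := by
        rw [div_le_iff₀ (by linarith)]
        nlinarith
      linarith
    calc B = ∑ i, (2 * (Nat.log 2 (A i * x) : ℝ)) := rfl
      _ ≤ ∑ i, 4 * (Real.log (A i) + Real.log x) := sum_le_sum fun i _ => hterm i
      _ = 4 * (L + k * Real.log x) := by
          rw [hL, ← mul_sum, sum_add_distrib, sum_const, card_univ, Fintype.card_fin, nsmul_eq_mul]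
  -- the covariance: `E(WN) ≥ −B·E N`, `|E W| ≤ B`
  have h1 : -(B * ((∑ n ∈ range (x + 1), N n) / ((x : ℝ) + 1))) ≤
      (∑ n ∈ range (x + 1), W n * N n) / ((x : ℝ) + 1) := by
    rw [← mul_div_assoc, ← neg_div, div_le_div_iff_of_pos_right hY0, mul_sum, ← sum_neg_distrib]
    refine sum_le_sum fun n hn => ?_
    have hw := hWB n hn
    have hn0 := hN0 n
    have : -B ≤ W n := (abs_le.1 hw).1
    nlinarith
  have h2 : (∑ n ∈ range (x + 1), W n) / ((x : ℝ) + 1) ≤ B := by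
    rw [div_le_iff₀ hY0]
    calc ∑ n ∈ range (x + 1), W n ≤ ∑ n ∈ range (x + 1), B :=
          sum_le_sum fun n hn => (le_abs_self _).trans (hWB n hn)
      _ = B * ((x : ℝ) + 1) := by rw [sum_const, card_range, nsmul_eq_mul]; push_cast; ring
  have h3 : (∑ n ∈ range (x + 1), W n) / ((x : ℝ) + 1) * ((∑ n ∈ range (x + 1), N n) / ((x : ℝ) + 1)) ≤
      B * ((∑ n ∈ range (x + 1), N n) / ((x : ℝ) + 1)) :=
    mul_le_mul_of_nonneg_right h2 hEN0
  -- `2 B · E N ≤ 64 S (L + k)`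
  have h4 : B * ((∑ n ∈ range (x + 1), N n) / ((x : ℝ) + 1)) ≤ 32 * S * (L + k) := by
    calc B * ((∑ n ∈ range (x + 1), N n) / ((x : ℝ) + 1))
        ≤ (4 * (L + k * Real.log x)) * (8 * S / Real.log x) := mul_le_mul hBle hEN hEN0 (by positivity)
      _ = 32 * S * (L / Real.log x + k) := by field_simp; ring
      _ ≤ 32 * S * (L + k) := by
          refine mul_le_mul_of_nonneg_left ?_ (by positivity)
          have : L / Real.log x ≤ L := div_le_self hL0 hlogx1
          linarith
  linarith

end Summit.Parity.BatemanHorn.Cruxes.SystemMomentDeficit.Ideator3Sketch
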